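import Literature.InformationTheory.QuantumCodes.CSSParameters
import Literature.InformationTheory.QuantumCodes.HypergraphProductKernels
import HarnessLib

/-!
# Permutation equivalence of CSS codes: re-indexing checks and qubits preserves `d^X`, `d^Z`, `k`

Two CSS codes presented by check matrices are *permutation equivalent* when one is obtained from the
other by a bijective relabelling of the qubits (columns) together with bijective relabellings of the
`X`-checks and of the `Z`-checks (rows): `H'^X = H^X ∘ (ρ_X × σ)`, `H'^Z = H^Z ∘ (ρ_Z × σ)`. This is
the notion under which Lin–Pryadko enumerate two-block group-algebra codes "excluding
permutation-equivalent codes" [LinPryadko2024, §4.2] and under which the qec census (LADDER-QEC grid A)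
quotients its search space (census/SYMMETRIES.md "FACT P": a qubit bijection carrying the `X`-check
supports onto the `X`-check supports and the `Z`-check supports onto the `Z`-check supports preserves
`n, k, d_X, d_Z`). The content is elementary linear algebra — the weight-preserving linear bijection
`v ↦ v ∘ σ` of `𝔽₂^{Q'} → 𝔽₂^{Q}` carries `ker H'^Z` onto `ker H^Z` and `rs H'^X` onto `rs H^X` — and is
PROVED here once, in the vocabulary of `CSS.lean` (`CSSCode`, `dX`, `dZ`, `k`) and `CSSParameters.lean`
(`IsCode`), so that every concrete symmetry (translations, group automorphisms, block swap, `X ↔ Z`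
duality of two-block codes: `TwoBlockCodeEquivalences.lean`; the flat re-indexing of bivariate-bicycle
codes: `BivariateBicycleCodes.lean`) is a one-line instance.

Main declarations (all proved, no named facts):

* `CSSCode.reindex C eX eZ eQ` — the code with `H^X`, `H^Z` re-indexed along bijections
  `eX : RX ≃ RX'`, `eZ : RZ ≃ RZ'`, `eQ : Q ≃ Q'` (`Matrix.reindex`); `reindex_swap`.
* kernel / row-space / logical-set transport: `mulVec_reindex_eq_zero_iff`, `mem_rowSpace_reindex_iff`,
  `zLogical_reindex_iff`, `xLogical_reindex_iff`.
* **`reindex_dX`, `reindex_dZ`, `reindex_k`, `reindex_isCode_iff`** — the parameters are invariant.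
* the "FACT P" phrasing for an arbitrary second code `C'` whose matrices are LITERALLY submatrices of
  `C`'s along bijections: **`dX_eq_of_submatrix`, `dZ_eq_of_submatrix`, `k_eq_of_submatrix`,
  `isCode_iff_of_submatrix`**, and the pointwise forms a distance certificate consumes
  (`zLowerBound_of_submatrix`, `zWitness_of_submatrix` and `X` twins).

## References (locators read on the page)

* [LinPryadko2024] H.-K. Lin, L. P. Pryadko, *Quantum two-block group algebra codes*, Phys. Rev. A 109
  (2024) 022407 = arXiv:2306.16400: §4.2 "Code equivalence", Theorem 6 ("The complexity of enumerating
  2BGA codes can be significantly reduced by excluding permutation-equivalent codes", held text chunk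
  p0009 L66–98) and its proof, App. "Detailed proofs for Sec. 4" (chunk p0018 L3–50: a permutation
  matrix `S` acting by `S H_X (u;v) = (SAS⁻¹, SBS⁻¹)(Su; Sv)`, "scalar products and, in particular, the
  row orthogonality, are preserved by this transformation").
* [BravyiEtAl2024] S. Bravyi et al., *High-threshold and low-overhead fault-tolerant quantum memory*,
  Nature 627 (2024) 778 = arXiv:2308.07915: §4 proof of Lemma 1 (chunk p0009 L108–118: the definitions
  of `d^X`, `d^Z` transported here) and SI §9.2 (chunk p0021 L60: "a permutation of the physical qubits
  that is equivalent to a permutation of the checks").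
-/

namespace Literature.InformationTheory.QuantumCodes

open Matrix

/-! ### Matrix-level transport along a re-indexing -/

section MatrixReindex

variable {R R' Q Q' : Type*} [Fintype Q] [Fintype Q']

/-- Kernel transport: `(reindex eR eQ H) v = 0 ↔ H (v ∘ eQ) = 0` (the re-indexed matrix annihilates
`v` iff the original annihilates the pulled-back vector).
[cite: LinPryadko2024, App. proof of Thm 6(i) (arXiv:2306.16400 chunk p0018 L6–14)] -/
theorem mulVec_reindex_eq_zero_iff {K : Type*} [NonUnitalNonAssocSemiring K] (H : Matrix R Q K)
    (eR : R ≃ R') (eQ : Q ≃ Q') (v : Q' → K) : (reindex eR eQ H) *ᵥ v = 0 ↔ H *ᵥ (v ∘ eQ) = 0 := by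
  rw [reindex_apply, submatrix_mulVec_equiv, Equiv.symm_symm]
  refine ⟨fun h => funext fun i => ?_, fun h => by rw [h]; rfl⟩
  simpa using congr_fun h (eR i)

omit [Fintype Q] [Fintype Q'] in
/-- Row-space transport: `v ∈ rs (reindex eR eQ H) ↔ v ∘ eQ ∈ rs H`.
[cite: LinPryadko2024, App. proof of Thm 6(i) (arXiv:2306.16400 chunk p0018 L6–14)] -/
theorem mem_rowSpace_reindex_iff {K : Type*} [Field K] [Fintype R] [Fintype R'] (H : Matrix R Q K)
    (eR : R ≃ R') (eQ : Q ≃ Q') (v : Q' → K) :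
    v ∈ rowSpace (reindex eR eQ H) ↔ v ∘ eQ ∈ rowSpace H := by
  rw [mem_rowSpace_iff, mem_rowSpace_iff, reindex_apply]
  constructor
  · rintro ⟨w, hw⟩
    refine ⟨w ∘ eR, ?_⟩
    rw [← hw, submatrix_vecMul_equiv, Equiv.symm_symm]
    funext q
    simp
  · rintro ⟨w, hw⟩
    refine ⟨w ∘ eR.symm, ?_⟩
    have hw' : (w ∘ ⇑eR.symm) ∘ ⇑eR = w := by
      funext i; simp
    rw [submatrix_vecMul_equiv, Equiv.symm_symm, hw', hw]
    funext q
    simp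

end MatrixReindex

namespace CSSCode

variable {RX RZ Q RX' RZ' Q' : Type*} [Fintype Q] [Fintype Q']

/-! ### Re-indexing a CSS code -/

/-- **Re-indexed CSS code**: relabel the `X`-checks along `eX`, the `Z`-checks along `eZ` and the qubits
along `eQ` (all bijections). The commutation `H^X (H^Z)ᵀ = 0` is preserved ("the row orthogonality
(CSS-orthogonality) [is] preserved by this transformation").
[cite: LinPryadko2024, §4.2 Thm 6 and App. proof of (i) (arXiv:2306.16400 chunk p0009 L66–74, p0018 L3–14)] -/
def reindex (C : CSSCode RX RZ Q) (eX : RX ≃ RX') (eZ : RZ ≃ RZ') (eQ : Q ≃ Q') : CSSCode RX' RZ' Q' where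
  HX := Matrix.reindex eX eQ C.HX
  HZ := Matrix.reindex eZ eQ C.HZ
  comm := by
    rw [reindex_apply, reindex_apply, transpose_submatrix, submatrix_mul_equiv, C.comm, submatrix_zero]
    rfl

/-- `(C.reindex eX eZ eQ).HX = reindex eX eQ C.HX`. [cite: LinPryadko2024, §4.2 Thm 6 (arXiv:2306.16400 chunk p0009 L66–74)] -/
@[simp] theorem reindex_HX (C : CSSCode RX RZ Q) (eX : RX ≃ RX') (eZ : RZ ≃ RZ') (eQ : Q ≃ Q') :
    (C.reindex eX eZ eQ).HX = Matrix.reindex eX eQ C.HX := rfl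

/-- `(C.reindex eX eZ eQ).HZ = reindex eZ eQ C.HZ`. [cite: LinPryadko2024, §4.2 Thm 6 (arXiv:2306.16400 chunk p0009 L66–74)] -/
@[simp] theorem reindex_HZ (C : CSSCode RX RZ Q) (eX : RX ≃ RX') (eZ : RZ ≃ RZ') (eQ : Q ≃ Q') :
    (C.reindex eX eZ eQ).HZ = Matrix.reindex eZ eQ C.HZ := rfl

/-- Re-indexing commutes with the `X ↔ Z` exchange (definitional).
[cite: LinPryadko2024, §4.2 Thm 6(vi) (the CSS-dual code) (arXiv:2306.16400 chunk p0009 L88–91)] -/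
theorem reindex_swap (C : CSSCode RX RZ Q) (eX : RX ≃ RX') (eZ : RZ ≃ RZ') (eQ : Q ≃ Q') :
    (C.reindex eX eZ eQ).swap = C.swap.reindex eZ eX eQ := rfl

/-! ### Transport of kernels, row spaces and logical sets -/

/-- `H'^X v = 0 ↔ H^X (v ∘ eQ) = 0`. [cite: LinPryadko2024, App. proof of Thm 6(i) (arXiv:2306.16400 chunk p0018 L6–14)] -/
theorem reindex_HX_mulVec_eq_zero_iff (C : CSSCode RX RZ Q) (eX : RX ≃ RX') (eZ : RZ ≃ RZ')
    (eQ : Q ≃ Q') (v : Q' → ZMod 2) : (C.reindex eX eZ eQ).HX *ᵥ v = 0 ↔ C.HX *ᵥ (v ∘ eQ) = 0 :=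
  mulVec_reindex_eq_zero_iff C.HX eX eQ v

/-- `H'^Z v = 0 ↔ H^Z (v ∘ eQ) = 0`. [cite: LinPryadko2024, App. proof of Thm 6(i) (arXiv:2306.16400 chunk p0018 L6–14)] -/
theorem reindex_HZ_mulVec_eq_zero_iff (C : CSSCode RX RZ Q) (eX : RX ≃ RX') (eZ : RZ ≃ RZ')
    (eQ : Q ≃ Q') (v : Q' → ZMod 2) : (C.reindex eX eZ eQ).HZ *ᵥ v = 0 ↔ C.HZ *ᵥ (v ∘ eQ) = 0 :=
  mulVec_reindex_eq_zero_iff C.HZ eZ eQ v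

/-- `v ∈ rs H'^X ↔ v ∘ eQ ∈ rs H^X`. [cite: LinPryadko2024, App. proof of Thm 6(i) (arXiv:2306.16400 chunk p0018 L6–14)] -/
theorem mem_rowSpX_reindex_iff [Fintype RX] [Fintype RX'] (C : CSSCode RX RZ Q) (eX : RX ≃ RX')
    (eZ : RZ ≃ RZ') (eQ : Q ≃ Q') (v : Q' → ZMod 2) :
    v ∈ (C.reindex eX eZ eQ).rowSpX ↔ v ∘ eQ ∈ C.rowSpX :=
  mem_rowSpace_reindex_iff C.HX eX eQ v

/-- `v ∈ rs H'^Z ↔ v ∘ eQ ∈ rs H^Z`. [cite: LinPryadko2024, App. proof of Thm 6(i) (arXiv:2306.16400 chunk p0018 L6–14)] -/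
theorem mem_rowSpZ_reindex_iff [Fintype RZ] [Fintype RZ'] (C : CSSCode RX RZ Q) (eX : RX ≃ RX')
    (eZ : RZ ≃ RZ') (eQ : Q ≃ Q') (v : Q' → ZMod 2) :
    v ∈ (C.reindex eX eZ eQ).rowSpZ ↔ v ∘ eQ ∈ C.rowSpZ :=
  mem_rowSpace_reindex_iff C.HZ eZ eQ v

/-- **`Z`-logical sets correspond**: `v` is a `Z`-type logical operator of the re-indexed code
(`H'^X v = 0`, `v ∉ rs H'^Z`) iff `v ∘ eQ` is one of `C`.
[cite: LinPryadko2024, §4.2 Thm 6 (permutation equivalence) (arXiv:2306.16400 chunk p0009 L66–74)] -/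
theorem zLogical_reindex_iff [Fintype RZ] [Fintype RZ'] (C : CSSCode RX RZ Q) (eX : RX ≃ RX')
    (eZ : RZ ≃ RZ') (eQ : Q ≃ Q') (v : Q' → ZMod 2) :
    ((C.reindex eX eZ eQ).HX *ᵥ v = 0 ∧ v ∉ (C.reindex eX eZ eQ).rowSpZ) ↔
      (C.HX *ᵥ (v ∘ eQ) = 0 ∧ v ∘ eQ ∉ C.rowSpZ) := by
  rw [reindex_HX_mulVec_eq_zero_iff, mem_rowSpZ_reindex_iff]

/-- **`X`-logical sets correspond** (`H'^Z v = 0`, `v ∉ rs H'^X` iff the same for `v ∘ eQ` in `C`).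
[cite: LinPryadko2024, §4.2 Thm 6 (permutation equivalence) (arXiv:2306.16400 chunk p0009 L66–74)] -/
theorem xLogical_reindex_iff [Fintype RX] [Fintype RX'] (C : CSSCode RX RZ Q) (eX : RX ≃ RX')
    (eZ : RZ ≃ RZ') (eQ : Q ≃ Q') (v : Q' → ZMod 2) :
    ((C.reindex eX eZ eQ).HZ *ᵥ v = 0 ∧ v ∉ (C.reindex eX eZ eQ).rowSpX) ↔
      (C.HZ *ᵥ (v ∘ eQ) = 0 ∧ v ∘ eQ ∉ C.rowSpX) := by
  rw [reindex_HZ_mulVec_eq_zero_iff, mem_rowSpX_reindex_iff]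

/-! ### Invariance of the parameters -/

/-- **`d^X` is a permutation invariant**: `d^X(C.reindex eX eZ eQ) = d^X(C)` (the weight-preserving
bijection `v ↦ v ∘ eQ` maps `ker H'^Z ∖ rs H'^X` onto `ker H^Z ∖ rs H^X`).
[cite: LinPryadko2024, §4.2 Thm 6 and App. proof (arXiv:2306.16400 chunk p0009 L66–74, p0018 L3–14)]
[cite: BravyiEtAl2024, §4 proof of Lemma 1 "d^X = min{|v| : v ∈ ker H^Z ∖ rs H^X}" (arXiv:2308.07915 chunk p0009 L115)] -/
theorem reindex_dX [Fintype RX] [Fintype RX'] (C : CSSCode RX RZ Q) (eX : RX ≃ RX') (eZ : RZ ≃ RZ')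
    (eQ : Q ≃ Q') : (C.reindex eX eZ eQ).dX = C.dX := by
  unfold CSSCode.dX
  congr 1
  refine Set.ext fun w => ⟨?_, ?_⟩
  · rintro ⟨v, ⟨hv, hv'⟩, rfl⟩
    have h := (C.xLogical_reindex_iff eX eZ eQ v).1 ⟨hv, hv'⟩
    exact ⟨v ∘ eQ, ⟨h.1, h.2⟩, hammingNorm_comp_equiv v eQ.symm⟩
  · rintro ⟨u, ⟨hu, hu'⟩, rfl⟩
    have hcomp : (u ∘ eQ.symm) ∘ eQ = u := by
      funext q; simp
    have h := (C.xLogical_reindex_iff eX eZ eQ (u ∘ eQ.symm)).2 (by rw [hcomp]; exact ⟨hu, hu'⟩)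
    refine ⟨u ∘ eQ.symm, ⟨h.1, h.2⟩, ?_⟩
    rw [← hammingNorm_comp_equiv (u ∘ eQ.symm) eQ.symm, Equiv.symm_symm, hcomp]

/-- **`d^Z` is a permutation invariant**: `d^Z(C.reindex eX eZ eQ) = d^Z(C)`.
[cite: LinPryadko2024, §4.2 Thm 6 and App. proof (arXiv:2306.16400 chunk p0009 L66–74, p0018 L3–14)]
[cite: BravyiEtAl2024, §4 proof of Lemma 1 "d^Z = min{|v| : v ∈ ker H^X ∖ rs H^Z}" (arXiv:2308.07915 chunk p0009 L117)] -/
theorem reindex_dZ [Fintype RZ] [Fintype RZ'] (C : CSSCode RX RZ Q) (eX : RX ≃ RX') (eZ : RZ ≃ RZ')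
    (eQ : Q ≃ Q') : (C.reindex eX eZ eQ).dZ = C.dZ := by
  change (C.reindex eX eZ eQ).swap.dX = C.swap.dX
  rw [reindex_swap, reindex_dX]

/-- **`k` is a permutation invariant**: `k(C.reindex eX eZ eQ) = k(C)` (ranks and the qubit count are
invariant under `Matrix.reindex`). [cite: LinPryadko2024, §4.2 Thm 6 (arXiv:2306.16400 chunk p0009 L66–74)]
[cite: BravyiEtAl2024, §4 proof of Lemma 1 "k = n − rk H^X − rk H^Z" (arXiv:2308.07915 chunk p0009 L80–83)] -/
theorem reindex_k [Fintype RX] [Fintype RX'] [Fintype RZ] [Fintype RZ'] (C : CSSCode RX RZ Q)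
    (eX : RX ≃ RX') (eZ : RZ ≃ RZ') (eQ : Q ≃ Q') : (C.reindex eX eZ eQ).k = C.k := by
  rw [CSSCode.k_eq, CSSCode.k_eq, reindex_HX, reindex_HZ, rank_reindex, rank_reindex,
    Fintype.card_congr eQ]

/-- The **census predicate `[[n, k, d]]` is a permutation invariant**: `C.reindex eX eZ eQ` is an
`[[n,k,d]]` code iff `C` is (`IsCode` reads the distance through `cssMinDist = min(d^X, d^Z)` / `⊤`).
[cite: LinPryadko2024, §4.2 Thm 6 "the 2BGA code LP[a,b] is equivalent to …" (same parameters) (arXiv:2306.16400 chunk p0009 L66–91)] -/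
theorem reindex_isCode_iff [Fintype RX] [Fintype RX'] [Fintype RZ] [Fintype RZ'] [DecidableEq Q]
    [DecidableEq Q'] (C : CSSCode RX RZ Q) (eX : RX ≃ RX') (eZ : RZ ≃ RZ') (eQ : Q ≃ Q') (n k d : ℕ) :
    (C.reindex eX eZ eQ).IsCode n k d ↔ C.IsCode n k d := by
  have hk := C.reindex_k eX eZ eQ
  have hmin : cssMinDist (C.reindex eX eZ eQ).HX (C.reindex eX eZ eQ).HZ = cssMinDist C.HX C.HZ := by
    rcases Nat.eq_zero_or_pos C.k with h0 | hpos
    · rw [cssMinDist_eq_top _ h0, cssMinDist_eq_top _ (hk.trans h0)]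
    · rw [cssMinDist_eq_min_dX_dZ _ hpos, cssMinDist_eq_min_dX_dZ _ (hk.symm ▸ hpos), reindex_dX,
        reindex_dZ]
  unfold IsCode
  rw [hk, hmin, Fintype.card_congr eQ]

/-! ### "FACT P": a second code whose matrices are literally submatrices along bijections -/

section Submatrix

variable {C : CSSCode RX RZ Q} {C' : CSSCode RX' RZ' Q'} {ρX : RX' ≃ RX} {ρZ : RZ' ≃ RZ} {σ : Q' ≃ Q}

/-- A code whose check matrices are `C`'s along bijections IS the re-indexed code.
[cite: LinPryadko2024, §4.2 Thm 6 (arXiv:2306.16400 chunk p0009 L66–74)] -/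
theorem eq_reindex_of_submatrix (hX : C'.HX = C.HX.submatrix ρX σ) (hZ : C'.HZ = C.HZ.submatrix ρZ σ) :
    C' = C.reindex ρX.symm ρZ.symm σ.symm := by
  obtain ⟨DX, DZ, hc⟩ := C'
  simp only at hX hZ
  subst hX; subst hZ
  simp [reindex, reindex_apply]

/-- **FACT P, `X`-distance.** If a bijection `σ` of the qubits together with bijections of the checks
carries `C`'s check matrices onto `C'`'s (`H'^X = H^X ∘ (ρ_X × σ)`, `H'^Z = H^Z ∘ (ρ_Z × σ)`), then
`d^X(C') = d^X(C)`. [cite: LinPryadko2024, §4.2 Thm 6 and App. proof (arXiv:2306.16400 chunk p0009 L66–74, p0018 L3–14)] -/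
theorem dX_eq_of_submatrix [Fintype RX] [Fintype RX'] (hX : C'.HX = C.HX.submatrix ρX σ)
    (hZ : C'.HZ = C.HZ.submatrix ρZ σ) : C'.dX = C.dX := by
  rw [eq_reindex_of_submatrix hX hZ, reindex_dX]

/-- **FACT P, `Z`-distance**: `d^Z(C') = d^Z(C)` under the same hypotheses.
[cite: LinPryadko2024, §4.2 Thm 6 and App. proof (arXiv:2306.16400 chunk p0009 L66–74, p0018 L3–14)] -/
theorem dZ_eq_of_submatrix [Fintype RZ] [Fintype RZ'] (hX : C'.HX = C.HX.submatrix ρX σ)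
    (hZ : C'.HZ = C.HZ.submatrix ρZ σ) : C'.dZ = C.dZ := by
  rw [eq_reindex_of_submatrix hX hZ, reindex_dZ]

/-- **FACT P, dimension**: `k(C') = k(C)` under the same hypotheses.
[cite: LinPryadko2024, §4.2 Thm 6 (arXiv:2306.16400 chunk p0009 L66–74)] -/
theorem k_eq_of_submatrix [Fintype RX] [Fintype RX'] [Fintype RZ] [Fintype RZ']
    (hX : C'.HX = C.HX.submatrix ρX σ) (hZ : C'.HZ = C.HZ.submatrix ρZ σ) : C'.k = C.k := by
  rw [eq_reindex_of_submatrix hX hZ, reindex_k]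

/-- **FACT P, census predicate**: `C'` is `[[n,k,d]]` iff `C` is, under the same hypotheses.
[cite: LinPryadko2024, §4.2 Thm 6 (arXiv:2306.16400 chunk p0009 L66–91)] -/
theorem isCode_iff_of_submatrix [Fintype RX] [Fintype RX'] [Fintype RZ] [Fintype RZ'] [DecidableEq Q]
    [DecidableEq Q'] (hX : C'.HX = C.HX.submatrix ρX σ) (hZ : C'.HZ = C.HZ.submatrix ρZ σ) (n k d : ℕ) :
    C'.IsCode n k d ↔ C.IsCode n k d := by
  rw [eq_reindex_of_submatrix hX hZ, reindex_isCode_iff]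

/-- Pointwise transport, `Z` side, universal form: a lower bound "every `Z`-logical of `C'` has weight
`≥ d`" transfers to `C` (the shape a lower-bound certificate checked on `C'` delivers).
[cite: BravyiEtAl2024, §4 proof of Lemma 1 (d^Z) (arXiv:2308.07915 chunk p0009 L117)] -/
theorem zLowerBound_of_submatrix [Fintype RZ] [Fintype RZ'] (hX : C'.HX = C.HX.submatrix ρX σ)
    (hZ : C'.HZ = C.HZ.submatrix ρZ σ) {d : ℕ}
    (h : ∀ w : Q' → ZMod 2, C'.HX *ᵥ w = 0 → w ∉ C'.rowSpZ → d ≤ hammingNorm w) :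
    ∀ v : Q → ZMod 2, C.HX *ᵥ v = 0 → v ∉ C.rowSpZ → d ≤ hammingNorm v := by
  have e := eq_reindex_of_submatrix hX hZ
  subst e
  intro v hv hv'
  have hcomp : (v ∘ σ) ∘ σ.symm = v := by
    funext q; simp
  have hl := (C.zLogical_reindex_iff ρX.symm ρZ.symm σ.symm (v ∘ σ)).2 (by rw [hcomp]; exact ⟨hv, hv'⟩)
  have := h (v ∘ σ) hl.1 hl.2
  rwa [show hammingNorm (v ∘ σ) = hammingNorm v from hammingNorm_comp_equiv v σ.symm] at this

/-- Pointwise transport, `X` side, universal form. [cite: BravyiEtAl2024, §4 proof of Lemma 1 (d^X) (arXiv:2308.07915 chunk p0009 L115)] -/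
theorem xLowerBound_of_submatrix [Fintype RX] [Fintype RX'] (hX : C'.HX = C.HX.submatrix ρX σ)
    (hZ : C'.HZ = C.HZ.submatrix ρZ σ) {d : ℕ}
    (h : ∀ w : Q' → ZMod 2, C'.HZ *ᵥ w = 0 → w ∉ C'.rowSpX → d ≤ hammingNorm w) :
    ∀ v : Q → ZMod 2, C.HZ *ᵥ v = 0 → v ∉ C.rowSpX → d ≤ hammingNorm v := by
  have e := eq_reindex_of_submatrix hX hZ
  subst e
  intro v hv hv'
  have hcomp : (v ∘ σ) ∘ σ.symm = v := by
    funext q; simp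
  have hl := (C.xLogical_reindex_iff ρX.symm ρZ.symm σ.symm (v ∘ σ)).2 (by rw [hcomp]; exact ⟨hv, hv'⟩)
  have := h (v ∘ σ) hl.1 hl.2
  rwa [show hammingNorm (v ∘ σ) = hammingNorm v from hammingNorm_comp_equiv v σ.symm] at this

/-- Pointwise transport, `Z` side, existential form: a weight-`d` `Z`-logical of `C'` yields one of `C`
(the shape an upper-bound witness checked on `C'` delivers).
[cite: BravyiEtAl2024, §4 proof of Lemma 1 (d^Z) (arXiv:2308.07915 chunk p0009 L117)] -/
theorem zWitness_of_submatrix [Fintype RZ] [Fintype RZ'] (hX : C'.HX = C.HX.submatrix ρX σ)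
    (hZ : C'.HZ = C.HZ.submatrix ρZ σ) {d : ℕ}
    (h : ∃ w : Q' → ZMod 2, C'.HX *ᵥ w = 0 ∧ w ∉ C'.rowSpZ ∧ hammingNorm w = d) :
    ∃ v : Q → ZMod 2, C.HX *ᵥ v = 0 ∧ v ∉ C.rowSpZ ∧ hammingNorm v = d := by
  have e := eq_reindex_of_submatrix hX hZ
  subst e
  obtain ⟨w, hw, hw', hwd⟩ := h
  have hl := (C.zLogical_reindex_iff ρX.symm ρZ.symm σ.symm w).1 ⟨hw, hw'⟩
  exact ⟨w ∘ σ.symm, hl.1, hl.2, by rw [hammingNorm_comp_equiv, hwd]⟩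

/-- Pointwise transport, `X` side, existential form. [cite: BravyiEtAl2024, §4 proof of Lemma 1 (d^X) (arXiv:2308.07915 chunk p0009 L115)] -/
theorem xWitness_of_submatrix [Fintype RX] [Fintype RX'] (hX : C'.HX = C.HX.submatrix ρX σ)
    (hZ : C'.HZ = C.HZ.submatrix ρZ σ) {d : ℕ}
    (h : ∃ w : Q' → ZMod 2, C'.HZ *ᵥ w = 0 ∧ w ∉ C'.rowSpX ∧ hammingNorm w = d) :
    ∃ v : Q → ZMod 2, C.HZ *ᵥ v = 0 ∧ v ∉ C.rowSpX ∧ hammingNorm v = d := by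
  have e := eq_reindex_of_submatrix hX hZ
  subst e
  obtain ⟨w, hw, hw', hwd⟩ := h
  have hl := (C.xLogical_reindex_iff ρX.symm ρZ.symm σ.symm w).1 ⟨hw, hw'⟩
  exact ⟨w ∘ σ.symm, hl.1, hl.2, by rw [hammingNorm_comp_equiv, hwd]⟩

end Submatrix

end CSSCode

end Literature.InformationTheory.QuantumCodes
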